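import Literature.NumberTheory.Automorphic.ClozelAlgebraicityCMUnitarityProofs
import Literature.NumberTheory.Automorphic.AutomorphicRepsGLSatakeUnitaryProofs
import Literature.NumberTheory.Automorphic.AutomorphicRepsGLCleanModelArch
import Literature.NumberTheory.Automorphic.AutomorphicRepsGLCuspidalUnitaryHolds
import Literature.NumberTheory.Automorphic.ArchParameterSplitCentre
import HarnessLib

/-!
# Clozel's algebraicity fact: clause (iv) ("`ℚ(π_f)` is totally real or CM") from clauses
# (i), (ii), (iii) — Patrikis's argument assembled on the Borel–Jacquet carriers (proofs)

Proofs-only companion (theorems, no definitions, no named facts) of `ClozelAlgebraicity.lean`,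
completing the chain `ClozelAlgebraicityCMProofs` → `ClozelAlgebraicityCMUnitarityProofs` for
clause (iv) of the named fact `Clozel1990_regularAlgebraic` (Clozel 1990, Thm. 3.13 with
Lemme 4.9; Patrikis 2019, Cor. 3.2.3). Patrikis's printed proof of (iv) is: "we may assume `π` is
unitary. The `L²` inner product then implies that `π^∨ ≅ ^cπ`, which in turn implies that for all
`σ ∈ Aut(ℂ)`, `^{cσ}π ≅ ^{σc}π`, and therefore that … `ℚ(π_f)` … is CM" (or totally real). Every
step now has a counterpart in the tree, and this file puts them together:

* "we may assume `π` is unitary": a cuspidal `π = W / W'` with an infinity type `T` has a CLEAN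
  cuspidal model `π₀ = C / ⊥` with the same Satake parameters and the same archimedean parameter
  (`CuspidalAutomorphicRepData.exists_clean_hasSatakeParamAt_hasArchParameter_of_sSup_irreducible`
  of `AutomorphicRepsGLCleanModelArch`, fed with the PROVED semisimplicity of `A_G`-invariant cusp
  forms `AutomorphicRepsGL.stable_cuspidal_eq_sSup_irreducible_holds`); on `C` the split centre
  `A_G` acts by `a ↦ a^s`, `s = ∑_σ ∑_i a_{σ,i}` (`ArchParameterSplitCentre`: the central
  `1 ∈ 𝔤𝔩ₙ(K_∞)` acts by `γ(1)(χ) = ∑ χ`, and `A_G = exp(ℝ · 1)`), and `s = n [K:ℚ] w / 2` when `T`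
  is pure of weight `w` (clause (iii)) — `HasArchParameter.apply_posRealScalar_mul_of_W'_eq_bot`,
  `HasInfinityType.apply_posRealScalar_mul_of_W'_eq_bot`; so `π₀ ⊗ |det|^{-w/2}` is `A_G`-invariant
  and carries the Petersson pairing.
* "`π^∨ ≅ ^cπ`" on unramified components: `{ā} = {q_v^{-w} a⁻¹}` for the Satake parameters of such
  a `π₀` (`CuspidalAutomorphicRepData.conj_shadow_of_apply_posRealScalar_mul_eq_cpow` of
  `AutomorphicRepsGLSatakeUnitaryProofs`, the Petersson-pairing unitarity).
* "`^{cσ}π ≅ ^{σc}π`, hence CM": `isTotallyReal_or_isCMField_ratField_of_conj_shadow` of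
  `ClozelAlgebraicityCMUnitarityProofs` (with `ClozelAlgebraicityCMProofs` and
  `NumberFields/TotallyRealOrCM`), given clause (i) and the conjugates of clause (ii).

Results:

* `CuspidalAutomorphicRepData.isTotallyReal_or_isCMField_ratField_of_clean_conjugates` — (iv) from
  (i) and clean cuspidal `σ`-conjugates on which `A_G` acts by `a ↦ a^{n[K:ℚ]w/2}`.
* `CuspidalAutomorphicRepData.isTotallyReal_or_isCMField_ratField_of_autConjugates_of_pure` —
  **(iv) from (i), an infinity type `T` of `π` pure of weight `w` on multisets, and for every `σ` a
  cuspidal `σ`-conjugate with an infinity type having the `a`-multisets of `^σT`** (`n ≥ 1`): the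
  clean model of the conjugate has exponent `∑_σ ∑ a(^σT) = ∑_σ ∑ a(T) = n [K:ℚ] w / 2`
  (`InfinityType.sum_sum_a_eq_of_map_a_eq_autConj`, `InfinityType.sum_sum_a_eq_of_pure`) and is
  again a `σ`-conjugate of `π` at almost all places.
* `CuspidalAutomorphicRepData.isTotallyReal_or_isCMField_ratField_of_clauses` — **clause (iv) of
  `Clozel1990_regularAlgebraic` for a cuspidal regular algebraic `π` on `GL_n(𝔸_K)`, `n ≥ 1`, follows
  from clauses (i), (ii), (iii) for that `π`**, in the binder shapes of the fact. So the four-clause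
  fact reduces to Clozel's Thm. 3.13 proper ((i), (ii): `ℚ(π_f)` is a number field and the
  `Aut(ℂ)`-conjugates exist, via the `ℚ`-structure on cuspidal cohomology) and Lemme 4.9 ((iii):
  archimedean purity, via the classification of generic unitary representations) — neither of
  which is in the tree yet.
* `AutomorphicRepData.ratField_eq_bot_of_rank_zero`, `…isTotallyReal_ratField_of_rank_zero` — for
  `GL_0` the only eigenvalue is `t_{v,0} = 1`, so `ℚ(π_f) = ℚ` (the fixed field of `Aut(ℂ)`), totally
  real; and **`Clozel1990_regularAlgebraic_of_clauses`** — the named fact follows from its clauses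
  (i), (ii), (iii) (all `n`).

## References

* S. Patrikis, *Variations on a theorem of Tate*, Mem. AMS 258 (2019) = arXiv:1207.6724, §2 and
  Cor. 3.2.3 with its proof [Patrikis2019].
* L. Clozel, *Motifs et formes automorphes: applications du principe de fonctorialité*, in
  Automorphic forms, Shimura varieties, and L-functions I (Ann Arbor 1988), Academic Press 1990,
  Thm. 3.13, Lemme 4.9 [Clozel1990].
* A. Borel, H. Jacquet, *Automorphic forms and automorphic representations*, Corvallis 1979, 4.6
  and 5.7 [BorelJacquet1979].
-/

-- Mathlib idiom (Mathlib/Algebra/Lie/OfAssociative.lean); needed to mention the Lie algebra of the datum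
attribute [local instance 100] LieRing.ofAssociativeRing

noncomputable section

open scoped Classical ComplexConjugate NNReal
open _root_.NumberField _root_.IsDedekindDomain

namespace Literature.NumberTheory.Automorphic

variable {n : ℕ} {K : Type} [Field K] [NumberField K] {hcpt : isCompact_glFiniteIntegralLevel n K}

/-! ### Clause (iv) from clause (i) and clean `A_G`-normalised conjugates (Petersson unitarity) -/

section CleanConjugates

/-- **Clause (iv) from clause (i) and clean, `A_G`-normalised cuspidal conjugates.** Let `π` be
cuspidal on `GL_n(𝔸_K)` (`n ≥ 1`) with `ratField π` finite over `ℚ`, and `w ∈ ℤ`. Suppose every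
`σ ∈ Aut(ℂ)` admits a cuspidal `σ`-conjugate `π_σ` of `π` at almost all places which is realised
on a subspace (`W' = ⊥`) and on whose forms the split centre acts by
`φ (a g) = a^{n [K:ℚ] w / 2} φ (g)` (`a ∈ A_G = ℝ_{>0}`) — for the genuine `^σπ` of Clozel's
Thm. 3.13, regular algebraic and pure of the same weight `w` as `π` (clause (iii),
`Clozel1990_regularAlgebraic.exists_autConjugate_pure_same_weight`), this is its archimedean
central character on `A_G`. Then `ratField π` is totally real or CM: by
`CuspidalAutomorphicRepData.conj_shadow_of_apply_posRealScalar_mul_eq_cpow` (Petersson pairing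
on the `A_G`-invariant twist `π_σ ⊗ |det|^{-w/2}`) the Satake parameters of `π_σ` satisfy
`0 ∉ α` and `{ā} = {q_v^{-w} a⁻¹}` at every unramified place, which is the hypothesis of
`isTotallyReal_or_isCMField_ratField_of_conj_shadow`. (Patrikis 2019, proof of Cor. 3.2.3: "we may
assume `π` is unitary. The `L²` inner product then implies that `π^∨ ≅ ^cπ` …".)
[cite: Patrikis2019, Cor. 3.2.3 (arXiv:1207.6724)] -/
theorem CuspidalAutomorphicRepData.isTotallyReal_or_isCMField_ratField_of_clean_conjugates
    [NeZero n] (π : CuspidalAutomorphicRepData n K hcpt) [FiniteDimensional ℚ (ratField π.1)]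
    (w : ℤ)
    (h : ∀ σ : ℂ ≃ₐ[ℚ] ℂ, ∃ π' : CuspidalAutomorphicRepData n K hcpt,
      IsAutConjugate σ π.1 π'.1 ∧ π'.1.W' = ⊥ ∧
        ∀ φ ∈ π'.1.W, ∀ (t : ℝ≥0ˣ) (g : (AdelicGroupData.gl n K).Adelic),
          φ ((show (AdelicGroupData.gl n K).Adelic from posRealScalar n K t) * g) =
            (((t : ℝ≥0) : ℝ) : ℂ) ^ (((n * Module.finrank ℚ K : ℕ) : ℂ) * w / 2) * φ g) :
    IsTotallyReal (ratField π.1) ∨ IsCMField (ratField π.1) := by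
  refine π.isTotallyReal_or_isCMField_ratField_of_conj_shadow w fun σ ↦ ?_
  obtain ⟨π', hc, hW', hμ⟩ := h σ
  refine ⟨π', hc, Filter.Eventually.of_forall fun v α hα ↦ ?_⟩
  obtain ⟨hne, hsh⟩ := π'.conj_shadow_of_apply_posRealScalar_mul_eq_cpow hW' hμ hα
  refine ⟨hne, ?_⟩
  rw [hsh]
  refine Multiset.map_congr rfl fun a _ ↦ ?_
  congr 1
  -- `q_v^{-2 re μ / (n[K:ℚ])} = q_v^{-w}` for `μ = n [K:ℚ] w / 2`
  have hn0 : (n : ℝ) ≠ 0 := by exact_mod_cast NeZero.ne n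
  have hd0 : (Module.finrank ℚ K : ℝ) ≠ 0 := by exact_mod_cast Module.finrank_pos.ne'
  have hμre : (((n * Module.finrank ℚ K : ℕ) : ℂ) * w / 2).re =
      ((n * Module.finrank ℚ K : ℕ) : ℝ) * (w : ℝ) / 2 := by
    have e : ((n * Module.finrank ℚ K : ℕ) : ℂ) * w / 2 =
        ((((n * Module.finrank ℚ K : ℕ) : ℝ) * (w : ℝ) / 2 : ℝ) : ℂ) := by
      push_cast
      ring
    rw [e, Complex.ofReal_re]
  have hexp : -(2 * (((n * Module.finrank ℚ K : ℕ) : ℝ) * (w : ℝ) / 2)) /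
      ((n * Module.finrank ℚ K : ℕ) : ℝ) = ((-w : ℤ) : ℝ) := by
    push_cast
    field_simp
  rw [hμre, hexp, Real.rpow_intCast, Complex.ofReal_zpow, Complex.ofReal_natCast]

end CleanConjugates

/-! ### The split centre acts on a clean datum through its infinity type -/

section SplitCentre

/-- **On a clean datum with archimedean parameter `χ`, `A_G` acts by `a ↦ a^{∑_σ ∑ χ(σ)}`**: for
`π = W / ⊥` with `HasArchParameter χ`, `φ (a g) = a^{s} φ (g)` for `φ ∈ W`, `a ∈ A_G = ℝ_{>0}`,
`s = ∑_σ ∑ χ(σ)` — the central `1 ∈ 𝔤𝔩ₙ(K_∞)` acts on `W = W / ⊥` by `s`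
(`HasArchParameter.lieDeriv_one_sub_smul_mem`) and `a = exp (log a · 1)`
(`apply_posRealScalar_mul_of_lieDeriv_one_eq_smul`). Borel–Jacquet 1979, 5.7; Clozel 1990, §3.3.
[cite: Clozel1990, §3.3] [cite: BorelJacquet1979, 5.7] -/
theorem AutomorphicRepData.HasArchParameter.apply_posRealScalar_mul_of_W'_eq_bot
    {π : AutomorphicRepData (AutomorphyDatum.gl n K hcpt)} {χ : (K →+* ℂ) → Multiset ℂ}
    (h : π.HasArchParameter χ) (hW' : π.W' = ⊥) {φ : (AdelicGroupData.gl n K).Adelic → ℂ}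
    (hφ : φ ∈ π.W) (t : ℝ≥0ˣ) (g : (AdelicGroupData.gl n K).Adelic) :
    φ ((show (AdelicGroupData.gl n K).Adelic from posRealScalar n K t) * g) =
      (((t : ℝ≥0) : ℝ) : ℂ) ^ (∑ σ : K →+* ℂ, (χ σ).sum) * φ g := by
  refine apply_posRealScalar_mul_of_lieDeriv_one_eq_smul (π.stable.isArchSmooth hφ) ?_ t g
  have h1 := h.lieDeriv_one_sub_smul_mem hφ
  rw [hW', Submodule.mem_bot, sub_eq_zero] at h1
  exact h1

/-- **On a clean datum with infinity type `T`, `A_G` acts by `a ↦ a^{∑_σ ∑_i a_{σ,i}}`.**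
Clozel 1990, §3.3. [cite: Clozel1990, §3.3] -/
theorem AutomorphicRepData.HasInfinityType.apply_posRealScalar_mul_of_W'_eq_bot
    {π : AutomorphicRepData (AutomorphyDatum.gl n K hcpt)} {T : InfinityType K n}
    (h : π.HasInfinityType T) (hW' : π.W' = ⊥) {φ : (AdelicGroupData.gl n K).Adelic → ℂ}
    (hφ : φ ∈ π.W) (t : ℝ≥0ˣ) (g : (AdelicGroupData.gl n K).Adelic) :
    φ ((show (AdelicGroupData.gl n K).Adelic from posRealScalar n K t) * g) =
      (((t : ℝ≥0) : ℝ) : ℂ) ^ (∑ σ : K →+* ℂ, ((T σ).map ArchWeight.a).sum) * φ g :=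
  h.2.apply_posRealScalar_mul_of_W'_eq_bot hW' hφ t g

/-- **On a clean datum with an infinity type pure of weight `w`, `A_G` acts by
`a ↦ a^{n [K:ℚ] w / 2}`** (`InfinityType.sum_sum_a_eq_of_pure`): the archimedean central character of
a representation pure of weight `w`, i.e. `π ⊗ |det|^{-w/2}` is `A_G`-invariant (Clozel 1990,
Lemme 4.9: "`π` cuspidale ⟹ `π ⊗ |det|^{w/2}` unitaire"; Patrikis 2019, proof of Cor. 3.2.3).
[cite: Clozel1990, Lemme 4.9] [cite: Patrikis2019, Cor. 3.2.3 (arXiv:1207.6724)] -/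
theorem AutomorphicRepData.HasInfinityType.apply_posRealScalar_mul_of_pure_of_W'_eq_bot
    {π : AutomorphicRepData (AutomorphyDatum.gl n K hcpt)} {T : InfinityType K n}
    (h : π.HasInfinityType T) {w : ℤ}
    (hw : ∀ ι : K →+* ℂ, (T ((starRingEnd ℂ).comp ι)).map ArchWeight.a =
      ((T ι).map ArchWeight.a).map fun a ↦ (w : ℂ) - a)
    (hW' : π.W' = ⊥) {φ : (AdelicGroupData.gl n K).Adelic → ℂ} (hφ : φ ∈ π.W) (t : ℝ≥0ˣ)
    (g : (AdelicGroupData.gl n K).Adelic) :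
    φ ((show (AdelicGroupData.gl n K).Adelic from posRealScalar n K t) * g) =
      (((t : ℝ≥0) : ℝ) : ℂ) ^ (((n * Module.finrank ℚ K : ℕ) : ℂ) * w / 2) * φ g := by
  rw [← InfinityType.sum_sum_a_eq_of_pure h.1.1 hw]
  exact h.apply_posRealScalar_mul_of_W'_eq_bot hW' hφ t g

end SplitCentre

/-! ### Assembly: clause (iv) from clauses (i), (ii), (iii) -/

section Assembly

/-- **Clause (iv) from clause (i), a pure infinity type, and the `Aut(ℂ)`-conjugates with their
infinity types** (`n ≥ 1`). Let `π` be cuspidal on `GL_n(𝔸_K)` with `ratField π` finite over `ℚ`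
(clause (i)) and an infinity type `T` pure of weight `w` on multisets (clause (iii)), and suppose
every `σ ∈ Aut(ℂ)` admits a cuspidal `σ`-conjugate `π_σ` of `π` at almost all places with an
infinity type `T_σ` whose `a`-multisets are those of `^σT` (clause (ii)). Then `ratField π` is
totally real or CM. Proof (Patrikis 2019, Cor. 3.2.3, "we may assume `π` is unitary …"): the clean
model `π₀` of `π_σ` (`exists_clean_hasSatakeParamAt_hasArchParameter_of_sSup_irreducible` with
`stable_cuspidal_eq_sSup_irreducible_holds`) has the Satake parameters of `π_σ`, hence is again a
`σ`-conjugate of `π` at almost all places (`hasSatakeParamAt_cofinite_holds`,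
`hasSatakeParamAt_unique_holds`), and the infinity type `T_σ`; so `A_G` acts on it by `a ↦ a^s` with
`s = ∑_ι ∑ a(T_σ ι) = ∑_ι ∑ a(T ι) = n [K:ℚ] w / 2` (`InfinityType.sum_sum_a_eq_of_map_a_eq_autConj`,
`InfinityType.sum_sum_a_eq_of_pure`), and `isTotallyReal_or_isCMField_ratField_of_clean_conjugates`
applies. [cite: Patrikis2019, Cor. 3.2.3 (arXiv:1207.6724)] [cite: Clozel1990, Thm. 3.13 and Lemme 4.9] -/
theorem CuspidalAutomorphicRepData.isTotallyReal_or_isCMField_ratField_of_autConjugates_of_pure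
    [NeZero n] (π : CuspidalAutomorphicRepData n K hcpt) [FiniteDimensional ℚ (ratField π.1)]
    {T : InfinityType K n} (hT : π.1.HasInfinityType T) {w : ℤ}
    (hw : ∀ ι : K →+* ℂ, (T ((starRingEnd ℂ).comp ι)).map ArchWeight.a =
      ((T ι).map ArchWeight.a).map fun a ↦ (w : ℂ) - a)
    (h : ∀ σ : ℂ ≃ₐ[ℚ] ℂ, ∃ π' : CuspidalAutomorphicRepData n K hcpt,
      IsAutConjugate σ π.1 π'.1 ∧ ∃ T' : InfinityType K n, π'.1.HasInfinityType T' ∧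
        ∀ ι : K →+* ℂ, (T' ι).map ArchWeight.a = (T.autConj σ ι).map ArchWeight.a) :
    IsTotallyReal (ratField π.1) ∨ IsCMField (ratField π.1) := by
  refine π.isTotallyReal_or_isCMField_ratField_of_clean_conjugates w fun σ ↦ ?_
  obtain ⟨π', hc, T', hT', ha⟩ := h σ
  obtain ⟨π₀, h0, h0π', harch⟩ :=
    π'.exists_clean_hasSatakeParamAt_hasArchParameter_of_sSup_irreducible
      AutomorphicRepsGL.stable_cuspidal_eq_sSup_irreducible_holds
  have hT₀ : π₀.1.HasInfinityType T' := ⟨hT'.1, harch _ hT'.2⟩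
  -- the exponent: `∑ a(T') = ∑ a(T) = n [K:ℚ] w / 2`
  have hs : ∑ ι : K →+* ℂ, ((T' ι).map ArchWeight.a).sum =
      ((n * Module.finrank ℚ K : ℕ) : ℂ) * w / 2 := by
    rw [InfinityType.sum_sum_a_eq_of_map_a_eq_autConj σ ha, InfinityType.sum_sum_a_eq_of_pure hT.1.1 hw]
  refine ⟨π₀, ?_, h0, fun φ hφ t g ↦ ?_⟩
  · -- the clean model is again a `σ`-conjugate of `π` at almost all places
    change ∀ᶠ v : HeightOneSpectrum (𝓞 K) in Filter.cofinite, _ at hc ⊢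
    filter_upwards [hc, AutomorphicRepData.hasSatakeParamAt_cofinite_holds π₀.1] with v hv hv₀
    obtain ⟨α, α', hα, hα', he⟩ := hv
    obtain ⟨β, hβ⟩ := hv₀
    have hβα' : β = α' := AutomorphicRepData.hasSatakeParamAt_unique_holds π'.1 (h0π' v β hβ) hα'
    exact ⟨α, β, hα, hβ, fun i hi ↦ by rw [hβα']; exact he i hi⟩
  · rw [← hs]
    exact hT₀.apply_posRealScalar_mul_of_W'_eq_bot h0 hφ t g

/-- **Clause (iv) of `Clozel1990_regularAlgebraic` from clauses (i), (ii), (iii), for one cuspidal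
regular algebraic `π` on `GL_n(𝔸_K)`, `n ≥ 1`**, in the binder shapes of the fact: if `ratField π`
is finite over `ℚ` (i), every `σ ∈ Aut(ℂ)` has a cuspidal `σ`-conjugate of `π` whose infinity type
has the `a`-multisets of `^σT` for every regular algebraic infinity type `T` of `π` (ii), and every
regular algebraic infinity type of `π` is pure of some integer weight on multisets (iii), then
`ratField π` is totally real or CM (iv). This is Patrikis 2019, Cor. 3.2.3 deduced from Clozel
1990, Thm. 3.13 and Lemme 4.9, with the unitarity / `L²` step carried out on the tree's carriers
(`isTotallyReal_or_isCMField_ratField_of_autConjugates_of_pure`). What it leaves of the named fact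
is exactly Clozel's Thm. 3.13 ((i), (ii)) and Lemme 4.9 ((iii)).
[cite: Patrikis2019, Cor. 3.2.3 (arXiv:1207.6724)] [cite: Clozel1990, Thm. 3.13 and Lemme 4.9] -/
theorem CuspidalAutomorphicRepData.isTotallyReal_or_isCMField_ratField_of_clauses [NeZero n]
    (π : CuspidalAutomorphicRepData n K hcpt) (hπ : π.1.IsRegularAlgebraic)
    (hi : FiniteDimensional ℚ (ratField π.1))
    (hii : ∀ σ : ℂ ≃ₐ[ℚ] ℂ, ∃ π' : CuspidalAutomorphicRepData n K hcpt,
      IsAutConjugate σ π.1 π'.1 ∧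
      ∀ T : InfinityType K n, π.1.HasInfinityType T → T.IsRegularAlgebraic →
        ∃ T' : InfinityType K n, π'.1.HasInfinityType T' ∧
          ∀ ι : K →+* ℂ, (T' ι).map ArchWeight.a = (T.autConj σ ι).map ArchWeight.a)
    (hiii : ∀ T : InfinityType K n, π.1.HasInfinityType T → T.IsRegularAlgebraic →
      ∃ w : ℤ, ∀ ι : K →+* ℂ, (T ((starRingEnd ℂ).comp ι)).map ArchWeight.a =
        ((T ι).map ArchWeight.a).map fun a => (w : ℂ) - a) :
    IsTotallyReal (ratField π.1) ∨ IsCMField (ratField π.1) := by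
  obtain ⟨T, hT, hreg⟩ := hπ
  obtain ⟨w, hw⟩ := hiii T hT hreg
  haveI := hi
  exact π.isTotallyReal_or_isCMField_ratField_of_autConjugates_of_pure hT hw fun σ ↦
    let ⟨π', hc, hT'⟩ := hii σ
    let ⟨T', hT'π, ha⟩ := hT' T hT hreg
    ⟨π', hc, T', hT'π, ha⟩

end Assembly

/-! ### The degenerate rank `n = 0`, and the fact from its clauses (i), (ii), (iii) -/

section RankZero

open scoped Cardinal

/-- `e_0(α) = 1`. [folklore] -/
theorem heckeEigenvalueOf_zero_zero (v : HeightOneSpectrum (𝓞 K)) (α : Multiset ℂ) :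
    heckeEigenvalueOf 0 v α 0 = 1 := by
  simp [heckeEigenvalueOf, Multiset.esymm, Multiset.powersetCard_zero_left]

/-- **For `GL_0` the rationality field is `ℚ`**: the only unramified Hecke eigenvalue is
`t_{v,0} = 1`, so every `σ ∈ Aut(ℂ)` stabilises the eigensystem and `ℚ(π_f)` is the fixed field of
all of `Aut(ℂ)`, which is `ℚ` (`mem_of_mem_ratField_of_heckeEigenvalue_mem` with the countable
subfield `ℚ ⊆ ℂ`; Lang, *Algebra*, VIII §1). [folklore] -/
theorem AutomorphicRepData.ratField_eq_bot_of_rank_zero {hcpt : isCompact_glFiniteIntegralLevel 0 K}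
    (π : AutomorphicRepData (AutomorphyDatum.gl 0 K hcpt)) : ratField π = ⊥ := by
  refine le_bot_iff.1 fun z hz ↦ ?_
  have hE : ∀ᶠ v : HeightOneSpectrum (𝓞 K) in Filter.cofinite, ∀ α : Multiset ℂ,
      π.HasSatakeParamAt v α → ∀ i ≤ 0, heckeEigenvalueOf 0 v α i ∈ (⊥ : Subfield ℂ) :=
    Filter.Eventually.of_forall fun v α _ i hi ↦ by
      obtain rfl := Nat.le_zero.1 hi
      rw [heckeEigenvalueOf_zero_zero]
      exact Subfield.one_mem _
  have hc : #(⊥ : Subfield ℂ) ≤ ℵ₀ := by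
    rw [Cardinal.mk_le_aleph0_iff, Subfield.bot_eq_of_charZero]
    have h : ((algebraMap ℚ ℂ).fieldRange : Set ℂ).Countable := by
      rw [RingHom.coe_fieldRange]
      exact Set.countable_range _
    exact h.to_subtype
  have hz' : z ∈ (⊥ : Subfield ℂ) := mem_of_mem_ratField_of_heckeEigenvalue_mem π hc hE hz
  rw [Subfield.bot_eq_of_charZero, RingHom.mem_fieldRange] at hz'
  exact IntermediateField.mem_bot.2 hz'

/-- For `GL_0`, `ℚ(π_f) = ℚ` is totally real (clause (iv) in rank `0`). [folklore] -/
theorem AutomorphicRepData.isTotallyReal_ratField_of_rank_zero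
    {hcpt : isCompact_glFiniteIntegralLevel 0 K} (π : AutomorphicRepData (AutomorphyDatum.gl 0 K hcpt)) :
    IsTotallyReal (ratField π) := by
  rw [π.ratField_eq_bot_of_rank_zero]
  infer_instance

end RankZero

section Fact

/-- **The named fact `Clozel1990_regularAlgebraic` follows from its clauses (i), (ii), (iii)**:
clause (iv) ("`ℚ(π_f)` is totally real or CM", Patrikis 2019, Cor. 3.2.3) is a CONSEQUENCE of
(i) `ℚ(π_f)` a number field, (ii) the cuspidal `Aut(ℂ)`-conjugates with the conjugate infinity
types, and (iii) archimedean purity (Clozel 1990, Thm. 3.13 and Lemme 4.9) — by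
`CuspidalAutomorphicRepData.isTotallyReal_or_isCMField_ratField_of_clauses` for `n ≥ 1` and
`AutomorphicRepData.isTotallyReal_ratField_of_rank_zero` for `n = 0`. So what remains to be proved
of the fact is exactly Clozel's Thm. 3.13 ((i), (ii): the `ℚ`-structure of cuspidal cohomology) and
Lemme 4.9 ((iii): purity via the unitary generic classification at the archimedean places).
[cite: Patrikis2019, Cor. 3.2.3 (arXiv:1207.6724)] [cite: Clozel1990, Thm. 3.13 and Lemme 4.9] -/
theorem Clozel1990_regularAlgebraic_of_clauses
    (h : ∀ (n : ℕ) (K : Type) [Field K] [NumberField K] (hcpt : isCompact_glFiniteIntegralLevel n K)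
      (π : CuspidalAutomorphicRepData n K hcpt), π.1.IsRegularAlgebraic →
      FiniteDimensional ℚ (ratField π.1) ∧
      (∀ σ : ℂ ≃ₐ[ℚ] ℂ, ∃ π' : CuspidalAutomorphicRepData n K hcpt,
        IsAutConjugate σ π.1 π'.1 ∧
        ∀ T : InfinityType K n, π.1.HasInfinityType T → T.IsRegularAlgebraic →
          ∃ T' : InfinityType K n, π'.1.HasInfinityType T' ∧
            ∀ ι : K →+* ℂ, (T' ι).map ArchWeight.a = (T.autConj σ ι).map ArchWeight.a) ∧
      (∀ T : InfinityType K n, π.1.HasInfinityType T → T.IsRegularAlgebraic →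
        ∃ w : ℤ, ∀ ι : K →+* ℂ, (T ((starRingEnd ℂ).comp ι)).map ArchWeight.a =
          ((T ι).map ArchWeight.a).map fun a => (w : ℂ) - a)) :
    Clozel1990_regularAlgebraic := by
  intro n K _ _ hcpt π hπ
  obtain ⟨hi, hii, hiii⟩ := h n K hcpt π hπ
  refine ⟨hi, hii, hiii, ?_⟩
  rcases Nat.eq_zero_or_pos n with rfl | hn
  · exact Or.inl π.1.isTotallyReal_ratField_of_rank_zero
  · haveI : NeZero n := ⟨hn.ne'⟩
    exact π.isTotallyReal_or_isCMField_ratField_of_clauses hπ hi hii hiii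

end Fact

end Literature.NumberTheory.Automorphic
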